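import Summits.ABC.StewartYu.GenThreeBaseArch
import Mathlib.Data.Fin.Tuple.Sort
import Mathlib.Algebra.GCDMonoid.Finset
import HarnessLib

/-!
# Cell abc-stewartyu, WP-L.A shell (parcel P-A1): PRINT'S «WITHOUT LOSS OF GENERALITY» REDUCTIONS for the
# archimedean frame (Nesterenko 2003, p. 56: all `bₖ ≠ 0`, `A₁ ≤ … ≤ Aₙ`; Lemma 5.2: `b` primitive; (2.6): the
# non-trivial regime) — `DichotomyArch` from the dichotomy on REDUCED data

`Summits/ABC/StewartYu/GenThreeReduceArch.lean` — cell `abc-stewartyu` (HOME `run/shared/lean/pub/abc-stewartyu/`),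
route `YuMatveevShapeRat` (rung A1.L, crux r2 `ArchCoreRat`, stmt-ABC-20502), seat p4 (g9), parcel WP-L.A P-A1
(lit WP-LA-SPEC §12 A3: «the `DichotomyArch → CoreArch` bookkeeping of P-A1»).  Theorems only.

The per-rank dichotomy `GenThreeInductionArch.DichotomyArch C n` quantifies over ALL rank-`n` data of the internal
statement.  The analytic frame, as printed, works on REDUCED data only: (i) every coefficient `bₖ ≠ 0` — the
coordinates with `bₖ = 0` are deleted, which IS a Matveev step (`StepArch` with `m₀ = 1`, `D = 0`: fewer
logarithms, `Ω` only decreases since `Aₖ ≥ 1`, needs `C r ≤ C n`); (ii) `b` PRIMITIVE (`gcd = 1`; used in print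
only in Lemma 5.2, `φ = ±b`) — dividing `b` by `g = gcd b` divides `Λ` by `g`, and the bound / the step for `b/g`
(with the same `B`) give the bound / the step for `b` since `log|Λ| = log g + log|Λ/g| ≥ log|Λ/g|`; (iii) the
weights SORTED `A₁ ≤ … ≤ Aₙ` (a relabelling by `Tuple.sort`: the linear form, `Ω`, and hence the bound and the
step, are invariant under permutations of the index set); (iv) the NON-TRIVIAL REGIME (2.6)
`C(n)·Ω·log(eB) < ∑ Aⱼ|bⱼ| + log 2` (else Cor. 2.5, `GenThreeBaseArch.bound_of_trivial_regime`).
`dichotomyArch_of_reduced` packages (i)–(iv): the frame owes «bound ∨ step» only for reduced data in the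
non-trivial regime.

Contents: `stepArch_of_log_le` (the step is monotone in the old linear form), `linearForm_perm` / `prod_perm` /
`indep_perm` / `stepArch_perm` (permutation invariance), `stepArch_of_exists_eq_zero` (zero-coordinate deletion
as a step), `linearForm_smul` / `log_abs_linearForm_le_of_smul` / `stepArch_of_stepArch_smul` /
`exists_primitive` (the gcd reduction), `dichotomyArch_of_reduced`.

WHAT THIS IS NOT: no analytic content; no crux moves.

References: Yu. V. Nesterenko, LNM 1819 (2003), §2 p. 56 («one can assume without loss of generality that
`bₖ ≠ 0` … and that `A₁ ≤ … ≤ Aₙ`»), (2.6), Cor. 2.5, Lemma 5.2 (p. 99: `b` primitive).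
-/

noncomputable section

open Finset

namespace Summit.ABC.StewartYu.GenThreeReduceArch

open Summit.ABC.StewartYu.GenThreeInductionArch
open Summit.ABC.StewartYu.GenThreeBaseArch

variable {n : ℕ}

/-! ### The step is monotone in the old linear form -/

/-- A step for `(a, b′, A, B)` is a step for `(a, b, A, B)` as soon as `log|Λ(b′)| ≤ log|Λ(b)|` (only the
comparison clause sees the old linear form). [cite: Nesterenko2003, Prop 2.6 (2.10)] -/
theorem stepArch_of_log_le {C : ℕ → ℝ} {a : Fin n → ℚ} {b b' : Fin n → ℤ} {A : Fin n → ℝ} {B : ℝ}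
    (h : StepArch C n a b' A B)
    (hle : Real.log |∑ j, (b' j : ℝ) * Real.log (a j : ℝ)| ≤ Real.log |∑ j, (b j : ℝ) * Real.log (a j : ℝ)|) :
    StepArch C n a b A B := by
  obtain ⟨r, θ, m, A', B', D, hr, hθ, hindθ, hA', hA1', hm, hB', hcmp, hcost⟩ := h
  exact ⟨r, θ, m, A', B', D, hr, hθ, hindθ, hA', hA1', hm, hB', hcmp.trans hle, hcost⟩

/-! ### Permutation invariance (sorting the weights) -/

/-- The linear form is invariant under relabelling. [folklore] -/
theorem linearForm_perm (σ : Equiv.Perm (Fin n)) (a : Fin n → ℚ) (b : Fin n → ℤ) :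
    ∑ j, (b (σ j) : ℝ) * Real.log (a (σ j) : ℝ) = ∑ j, (b j : ℝ) * Real.log (a j : ℝ) :=
  Equiv.sum_comp σ (fun j => (b j : ℝ) * Real.log (a j : ℝ))

/-- `Ω` is invariant under relabelling. [folklore] -/
theorem prod_perm (σ : Equiv.Perm (Fin n)) (A : Fin n → ℝ) : ∏ j, A (σ j) = ∏ j, A j :=
  Equiv.prod_comp σ A

/-- Multiplicative independence is invariant under relabelling. [folklore] -/
theorem indep_perm (σ : Equiv.Perm (Fin n)) (a : Fin n → ℚ)
    (hind : ∀ μ : Fin n → ℤ, ∏ j, a j ^ μ j = 1 → μ = 0) :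
    ∀ μ : Fin n → ℤ, ∏ j, a (σ j) ^ μ j = 1 → μ = 0 := by
  intro μ hμ
  have h1 : ∏ j, a j ^ μ (σ.symm j) = 1 := by
    rw [← Equiv.prod_comp σ (fun j => a j ^ μ (σ.symm j))]
    simpa only [Equiv.symm_apply_apply] using hμ
  have h2 := hind (fun j => μ (σ.symm j)) h1
  funext i
  have h3 := congrFun h2 (σ i)
  simpa only [Equiv.symm_apply_apply, Pi.zero_apply] using h3

/-- A relabelled exponent vector is nonzero iff the original is. [folklore] -/
theorem comp_perm_ne_zero (σ : Equiv.Perm (Fin n)) {b : Fin n → ℤ} (hb : b ≠ 0) :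
    (fun j => b (σ j)) ≠ 0 := by
  intro h
  apply hb
  funext j
  have := congrFun h (σ.symm j)
  simpa only [Equiv.apply_symm_apply, Pi.zero_apply] using this

/-- **A step for the relabelled datum is a step for the datum.** [cite: Nesterenko2003, §2 p. 56 (`A₁ ≤ … ≤ Aₙ`)] -/
theorem stepArch_perm {C : ℕ → ℝ} (σ : Equiv.Perm (Fin n)) {a : Fin n → ℚ} {b : Fin n → ℤ} {A : Fin n → ℝ}
    {B : ℝ} (h : StepArch C n (fun j => a (σ j)) (fun j => b (σ j)) (fun j => A (σ j)) B) :
    StepArch C n a b A B := by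
  obtain ⟨r, θ, m, A', B', D, hr, hθ, hindθ, hA', hA1', hm, hB', hcmp, hcost⟩ := h
  rw [linearForm_perm σ a b] at hcmp
  rw [prod_perm σ A] at hcost
  exact ⟨r, θ, m, A', B', D, hr, hθ, hindθ, hA', hA1', hm, hB', hcmp, hcost⟩

/-! ### Deleting the zero coordinates is a Matveev step -/

/-- **Print's first WLOG as a step**: if some `bₖ = 0`, restricting to the support `s = {j : bⱼ ≠ 0}` (`r = |s| < n`
logarithms, same `B`, weights `A|ₛ`, `m₀ = 1`, `D = 0`) is a `StepArch`, provided `0 ≤ C n` and `C r ≤ C n`.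
[cite: Nesterenko2003, §2 p. 56 (`bₖ ≠ 0` WLOG)] -/
theorem stepArch_of_exists_eq_zero {C : ℕ → ℝ} (hC0 : 0 ≤ C n) (hCmono : ∀ r, r < n → C r ≤ C n)
    {a : Fin n → ℚ} {b : Fin n → ℤ} {A : Fin n → ℝ} {B : ℝ}
    (ha : ∀ j, 0 < a j) (hind : ∀ μ : Fin n → ℤ, ∏ j, a j ^ μ j = 1 → μ = 0)
    (hA : ∀ j, Height.logHeight₁ (a j) ≤ A j) (hA1 : ∀ j, 1 ≤ A j) (hb : b ≠ 0)
    (hB : ∀ j, (|b j| : ℝ) ≤ B) (hk : ∃ k, b k = 0) :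
    StepArch C n a b A B := by
  classical
  set s : Finset (Fin n) := Finset.univ.filter fun j => b j ≠ 0 with hs
  set r : ℕ := s.card with hrdef
  -- `r < n`
  obtain ⟨k, hk⟩ := hk
  have hks : k ∉ s := by simp [hs, hk]
  have hrn : r < n := by
    have h1 : s.card < (Finset.univ : Finset (Fin n)).card :=
      Finset.card_lt_card ⟨Finset.subset_univ _, fun h => hks (h (Finset.mem_univ k))⟩
    simpa [hrdef] using h1
  -- the enumeration of the support
  set e : Fin r ≃ s := s.equivFin.symm with he
  set θ : Fin r → ℚ := fun i => a (e i) with hθdef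
  set m : Fin r → ℤ := fun i => b (e i) with hmdef
  set A' : Fin r → ℝ := fun i => A (e i) with hA'def
  -- products over `Fin r` are products over `s`
  have hreidx : ∀ (f : Fin n → ℚ), ∏ i, f (e i) = ∏ j ∈ s, f j := by
    intro f
    rw [Equiv.prod_comp e (fun x : s => f x), Finset.prod_coe_sort]
  have hreidxR : ∀ (f : Fin n → ℝ), ∏ i, f (e i) = ∏ j ∈ s, f j := by
    intro f
    rw [Equiv.prod_comp e (fun x : s => f x), Finset.prod_coe_sort]
  -- the relation `∏ θᵐ = (∏ aᵇ)^1`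
  have hrel : ∏ i, θ i ^ m i = (∏ j, a j ^ b j) ^ (1 : ℤ) := by
    rw [zpow_one]
    have h1 : ∏ i, θ i ^ m i = ∏ j ∈ s, a j ^ b j := by
      simpa [hθdef, hmdef] using hreidx (fun j => a j ^ b j)
    rw [h1]
    exact Finset.prod_filter_of_ne fun j _ hj => by
      intro hbj; apply hj; rw [hbj, zpow_zero]
  -- independence of the restricted generators
  have hindθ : ∀ μ : Fin r → ℤ, ∏ i, θ i ^ μ i = 1 → μ = 0 := by
    intro μ hμ
    set μ' : Fin n → ℤ := fun j => if h : j ∈ s then μ (e.symm ⟨j, h⟩) else 0 with hμ'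
    have h1 : ∏ j, a j ^ μ' j = 1 := by
      have h2 : ∏ j, a j ^ μ' j = ∏ j ∈ s, a j ^ μ' j := by
        symm
        exact Finset.prod_filter_of_ne fun j _ hj => by
          by_contra hjs
          apply hj
          have : μ' j = 0 := by simp [hμ', hs] at hjs ⊢; intro h; exact absurd hjs h
          rw [this, zpow_zero]
      rw [h2, ← hreidx (fun j => a j ^ μ' j)]
      have h3 : ∀ i, a (e i) ^ μ' (e i) = θ i ^ μ i := by
        intro i
        have hmem : ((e i : s) : Fin n) ∈ s := (e i).2
        have : μ' (e i) = μ i := by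
          simp only [hμ', hmem, dite_true]
          congr 1
          have : (⟨((e i : s) : Fin n), hmem⟩ : s) = e i := Subtype.ext rfl
          rw [this, Equiv.symm_apply_apply]
        rw [this]
      rw [Finset.prod_congr rfl fun i _ => h3 i]
      exact hμ
    have h4 := hind μ' h1
    funext i
    have h5 := congrFun h4 (e i)
    have hmem : ((e i : s) : Fin n) ∈ s := (e i).2
    simp only [hμ', hmem, dite_true, Pi.zero_apply] at h5
    have : (⟨((e i : s) : Fin n), hmem⟩ : s) = e i := Subtype.ext rfl
    rw [this, Equiv.symm_apply_apply] at h5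
    exact h5
  -- `∏ A' ≤ ∏ A`
  have hprodle : ∏ i, A' i ≤ ∏ j, A j := by
    have h1 : ∏ i, A' i = ∏ j ∈ s, A j := by simpa [hA'def] using hreidxR A
    rw [h1, ← Finset.prod_filter_mul_prod_filter_not Finset.univ (fun j => b j ≠ 0) A]
    have h2 : 1 ≤ ∏ j ∈ Finset.univ.filter (fun j => ¬ b j ≠ 0), A j :=
      Finset.one_le_prod fun j _ => hA1 j
    have h3 : 0 ≤ ∏ j ∈ s, A j := Finset.prod_nonneg fun j _ => by linarith [hA1 j]
    calc ∏ j ∈ s, A j = (∏ j ∈ s, A j) * 1 := (mul_one _).symm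
      _ ≤ (∏ j ∈ s, A j) * ∏ j ∈ Finset.univ.filter (fun j => ¬ b j ≠ 0), A j :=
          mul_le_mul_of_nonneg_left h2 h3
  -- the cost line with `m₀ = 1`
  have hlogB : 0 ≤ Real.log (Real.exp 1 * B) := log_exp_one_mul_nonneg hb hB
  have hcost : C r * (∏ i, A' i) * Real.log (Real.exp 1 * B) + Real.log |((1 : ℤ) : ℝ)| ≤
      C n * (∏ j, A j) * Real.log (Real.exp 1 * B) := by
    have h0 : Real.log |((1 : ℤ) : ℝ)| = 0 := by simp
    rw [h0, add_zero]
    have hA'0 : 0 ≤ ∏ i, A' i := Finset.prod_nonneg fun i _ => by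
      have := hA1 (e i); simp only [hA'def]; linarith
    have h1 : C r * (∏ i, A' i) ≤ C n * (∏ j, A j) :=
      calc C r * (∏ i, A' i) ≤ C n * (∏ i, A' i) := mul_le_mul_of_nonneg_right (hCmono r hrn) hA'0
        _ ≤ C n * (∏ j, A j) := mul_le_mul_of_nonneg_left hprodle hC0
    exact mul_le_mul_of_nonneg_right h1 hlogB
  exact stepArch_of_pow_eq ha hind hb hrn θ m A' B (fun i => ha _) hindθ (fun i => hA _) (fun i => hA1 _)
    (fun i => hB _) 1 one_ne_zero hrel hcost

/-! ### The primitive exponent vector -/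

/-- `Λ(d·b′) = d·Λ(b′)`. [folklore] -/
theorem linearForm_smul (a : Fin n → ℚ) (d : ℤ) (b' : Fin n → ℤ) :
    ∑ j, ((d * b' j : ℤ) : ℝ) * Real.log (a j : ℝ) = (d : ℝ) * ∑ j, (b' j : ℝ) * Real.log (a j : ℝ) := by
  rw [Finset.mul_sum]
  refine Finset.sum_congr rfl fun j _ => ?_
  push_cast
  ring

/-- `log|Λ(b′)| ≤ log|Λ(d·b′)|` for an integer `d ≠ 0`. [cite: Nesterenko2003, Lemma 5.2 (p. 99, `b` primitive)] -/
theorem log_abs_linearForm_le_of_smul (a : Fin n → ℚ) {d : ℤ} (hd : d ≠ 0) (b' : Fin n → ℤ) :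
    Real.log |∑ j, (b' j : ℝ) * Real.log (a j : ℝ)| ≤
      Real.log |∑ j, ((d * b' j : ℤ) : ℝ) * Real.log (a j : ℝ)| := by
  rw [linearForm_smul, abs_mul]
  set L : ℝ := |∑ j, (b' j : ℝ) * Real.log (a j : ℝ)| with hL
  have hd1 : (1 : ℝ) ≤ |(d : ℝ)| := by exact_mod_cast Int.one_le_abs hd
  rcases eq_or_lt_of_le (abs_nonneg (∑ j, (b' j : ℝ) * Real.log (a j : ℝ))) with h0 | hpos
  · rw [← hL] at h0
    rw [← h0, mul_zero]
  · rw [← hL] at hpos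
    exact Real.log_le_log hpos (le_mul_of_one_le_left hpos.le hd1)

/-- **A step for `(a, b′, A, B)` is a step for `(a, d·b′, A, B)`** (`d ≠ 0`). [cite: Nesterenko2003, Lemma 5.2] -/
theorem stepArch_of_stepArch_smul {C : ℕ → ℝ} {a : Fin n → ℚ} {b' : Fin n → ℤ} {A : Fin n → ℝ} {B : ℝ}
    {d : ℤ} (hd : d ≠ 0) (h : StepArch C n a b' A B) :
    StepArch C n a (fun j => d * b' j) A B :=
  stepArch_of_log_le h (log_abs_linearForm_le_of_smul a hd b')

/-- **Extraction of the gcd**: a nonzero integer vector is `d · b′` with `d ≠ 0`, `b′ ≠ 0`, `gcd b′ = 1` and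
`|b′ⱼ| ≤ |bⱼ|`. [folklore] -/
theorem exists_primitive {b : Fin n → ℤ} (hb : b ≠ 0) :
    ∃ (d : ℤ) (b' : Fin n → ℤ), d ≠ 0 ∧ b' ≠ 0 ∧ (∀ j, b j = d * b' j) ∧ Finset.univ.gcd b' = 1 ∧
      ∀ j, |b' j| ≤ |b j| := by
  classical
  have hne : (Finset.univ : Finset (Fin n)).Nonempty := by
    by_contra h
    rw [Finset.not_nonempty_iff_eq_empty, Finset.univ_eq_empty_iff] at h
    exact hb (funext fun j => (IsEmpty.false j).elim)
  obtain ⟨g, hg, hgcd⟩ := Finset.extract_gcd b hne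
  set d : ℤ := Finset.univ.gcd b with hddef
  have hd : d ≠ 0 := by
    intro h0
    rw [hddef, Finset.gcd_eq_zero_iff] at h0
    exact hb (funext fun j => h0 j (Finset.mem_univ j))
  refine ⟨d, g, hd, ?_, fun j => hg j (Finset.mem_univ j), hgcd, ?_⟩
  · intro h0
    apply hb
    funext j
    rw [hg j (Finset.mem_univ j), h0]
    simp
  · intro j
    rw [hg j (Finset.mem_univ j), abs_mul]
    exact le_mul_of_one_le_left (abs_nonneg _) (Int.one_le_abs hd)

/-! ### The dichotomy from the dichotomy on reduced data -/

/-- **`DichotomyArch C n` from «bound ∨ step» on REDUCED data in the non-trivial regime**: the frame may assume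
every `bⱼ ≠ 0`, `gcd b = 1`, the weights sorted (`Monotone A`) and `C(n)·Ω·log(eB) < ∑ Aⱼ|bⱼ| + log 2`
(print's WLOG p. 56, Lemma 5.2's primitivity, (2.6)); requires `0 ≤ C n` and `C r ≤ C n` for `r < n`.
[cite: Nesterenko2003, §2 p. 56, (2.6), Cor 2.5, Lemma 5.2] -/
theorem dichotomyArch_of_reduced {C : ℕ → ℝ} (hC0 : 0 ≤ C n) (hCmono : ∀ r, r < n → C r ≤ C n)
    (h : ∀ (a : Fin n → ℚ) (b : Fin n → ℤ) (A : Fin n → ℝ) (B : ℝ),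
      (∀ j, 0 < a j) →
      (∀ μ : Fin n → ℤ, ∏ j, a j ^ μ j = 1 → μ = 0) →
      (∀ j, Height.logHeight₁ (a j) ≤ A j) → (∀ j, 1 ≤ A j) →
      (∀ j, b j ≠ 0) → Finset.univ.gcd b = 1 → Monotone A →
      (∀ j, (|b j| : ℝ) ≤ B) →
      C n * (∏ j, A j) * Real.log (Real.exp 1 * B) < ∑ j, A j * |(b j : ℝ)| + Real.log 2 →
      -(C n * (∏ j, A j) * Real.log (Real.exp 1 * B)) ≤
          Real.log |∑ j, (b j : ℝ) * Real.log (a j : ℝ)| ∨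
        StepArch C n a b A B) :
    DichotomyArch C n := by
  classical
  intro a b A B ha hind hA hA1 hb hB
  -- (iii) sort the weights
  set σ : Equiv.Perm (Fin n) := Tuple.sort A with hσ
  have hmono : Monotone (fun j => A (σ j)) := Tuple.monotone_sort A
  set a₁ : Fin n → ℚ := fun j => a (σ j) with ha₁
  set b₁ : Fin n → ℤ := fun j => b (σ j) with hb₁
  set A₁ : Fin n → ℝ := fun j => A (σ j) with hA₁
  have ha' : ∀ j, 0 < a₁ j := fun j => ha _
  have hind' := indep_perm σ a hind
  have hA' : ∀ j, Height.logHeight₁ (a₁ j) ≤ A₁ j := fun j => hA _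
  have hA1' : ∀ j, 1 ≤ A₁ j := fun j => hA1 _
  have hb' : b₁ ≠ 0 := comp_perm_ne_zero σ hb
  have hB' : ∀ j, (|b₁ j| : ℝ) ≤ B := fun j => hB _
  -- it suffices to settle the relabelled datum
  suffices hsuff : -(C n * (∏ j, A₁ j) * Real.log (Real.exp 1 * B)) ≤
        Real.log |∑ j, (b₁ j : ℝ) * Real.log (a₁ j : ℝ)| ∨ StepArch C n a₁ b₁ A₁ B by
    rcases hsuff with hle | hstep
    · left
      rw [show ∏ j, A₁ j = ∏ j, A j from prod_perm σ A,
        show ∑ j, (b₁ j : ℝ) * Real.log (a₁ j : ℝ) = ∑ j, (b j : ℝ) * Real.log (a j : ℝ) from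
          linearForm_perm σ a b] at hle
      exact hle
    · exact Or.inr (stepArch_perm σ hstep)
  -- (i) zero coordinates
  by_cases hz : ∃ k, b₁ k = 0
  · exact Or.inr (stepArch_of_exists_eq_zero hC0 hCmono ha' hind' hA' hA1' hb' hB' hz)
  push Not at hz
  -- (ii) gcd extraction
  obtain ⟨d, b₂, hd, hb₂, hdb, hgcd, hle₂⟩ := exists_primitive hb'
  have hb₂ne : ∀ j, b₂ j ≠ 0 := by
    intro j h0
    apply hz j
    rw [hdb j, h0, mul_zero]
  have hB₂ : ∀ j, (|b₂ j| : ℝ) ≤ B := fun j => le_trans (by exact_mod_cast hle₂ j) (hB' j)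
  have hfun : b₁ = fun j => d * b₂ j := funext hdb
  have hcmp : Real.log |∑ j, (b₂ j : ℝ) * Real.log (a₁ j : ℝ)| ≤
      Real.log |∑ j, (b₁ j : ℝ) * Real.log (a₁ j : ℝ)| := by
    rw [hfun]
    exact log_abs_linearForm_le_of_smul a₁ hd b₂
  -- (iv) the regime, for the primitive datum
  by_cases hbound : -(C n * (∏ j, A₁ j) * Real.log (Real.exp 1 * B)) ≤
      Real.log |∑ j, (b₂ j : ℝ) * Real.log (a₁ j : ℝ)|
  · exact Or.inl (hbound.trans hcmp)
  have hreg := regime_of_not_le a₁ ha' hind' A₁ hA' b₂ hb₂ hbound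
  rcases h a₁ b₂ A₁ B ha' hind' hA' hA1' hb₂ne hgcd hmono hB₂ hreg with hle | hstep
  · exact Or.inl (hle.trans hcmp)
  · right
    rw [hfun]
    exact stepArch_of_stepArch_smul hd hstep

end Summit.ABC.StewartYu.GenThreeReduceArch

end
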